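import Literature.NumberTheory.EllipticCurves.MasserWustholzSurjectivityProofs
import Literature.NumberTheory.EllipticCurves.MasserWustholzIsogenyArgumentsProofs
import Literature.NumberTheory.EllipticCurves.MasserWustholzSubfieldReductionProofs
import HarnessLib

/-!
# Masser–Wüstholz 1993 over `ℚ`: the shape of the discharge (assembly of §§3–4)

Topic `NumberTheory/EllipticCurves`; a proofs-only sibling (theorems only: no definitions, no
named facts) of `MasserWustholzSurjectivity` (the named fact
`Literature.NumberTheory.EllipticCurves.masserWustholz_surjective_modEll`: D. W. Masser,
G. Wüstholz, *Galois properties of division fields of elliptic curves*, Bull. London Math. Soc.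
**25** (1993) 247–254, Theorem (b) at `k = ℚ`, Faltings-height form).  It assembles the three
siblings `MasserWustholzSurjectivityProofs` (§4: group theory and part (b); the fact from
`h31`, `h32`), `MasserWustholzIsogenyArgumentsProofs` (§3: Lemma 3.1 modulo the isogeny
estimate) and `MasserWustholzSubfieldReductionProofs` (§4: the passage to the fields `k₀` of
degree `≤ 60`) into the final statement of what a discharge of the named fact still requires:

* `MasserWustholz1993.effectiveLemma31_numberFields_of_isogenyEstimate` — (4.1) over the fields
  `k₀`: Lemma 3.1 over number fields of degree `≤ 60` from the isogeny estimate there.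
* `MasserWustholz1993.effectiveLemma31_of_mazur` — over `ℚ` itself, (4.1) is also a consequence
  of Mazur's theorem on rational isogenies of prime degree (the tree's named fact
  `mazur_isogeny_irreducible`, not proved in the tree): `c = 163`, `γ = 0`.
* `MasserWustholz1993.masserWustholz_surjective_modEll_of_isogenyEstimate_of_lemma32` — **the
  named fact from (I) the isogeny estimate for elliptic curves over number fields of degree
  `≤ 60` (Lemma 2.2 at `n = 1`: Masser–Wüstholz, Ann. of Math. 137 (1993) 459–472, Theorem with
  §6; explicit form Gaudron–Rémond, Comment. Math. Helv. 89 (2014), Thm. 1.4) and (II) Lemma 3.2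
  over the same fields (commutative `φ_ℓ(G)` ⇒ scalar; from Lemma 2.2 at `n = 2` and the
  quotient `(E × E)/Γ_f`).**  (I) and (II) are the transcendence input of the paper; they are
  hypotheses of the theorem, stated in the tree's vocabulary, and are NOT introduced as named
  facts (D-0026).  Everything else in the paper is proved in the tree.

## References

* [MasserWustholzBLMS1993] D. W. Masser, G. Wüstholz, Bull. London Math. Soc. 25 (1993)
  247–254: Theorem (p. 247), §2 Lemma 2.2, §3 Lemmas 3.1–3.2, §4 (pp. 248–251).
* [Mazur1978] B. Mazur, Invent. Math. 44 (1978) 129–162, Thm. 1.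
-/

noncomputable section

open scoped Classical

namespace Literature.NumberTheory.EllipticCurves.MasserWustholz1993

open _root_.WeierstrassCurve Field

/-- **(4.1) over the fields `k₀`: the effective Lemma 3.1 over number fields of degree `≤ 60` from
the isogeny estimate there.**  If there are absolute `c, γ ≥ 0` such that for every number field
`k` with `[k : ℚ] ≤ 60`, every non-CM `E/k` and every `E'` isogenous to `E` over `k` there is an
isogeny `E' → E` over `k` of degree `≤ c · max(1, h_F(E))^γ` (Lemma 2.2 at `n = 1` with
`M = max{d, h} ≤ 60 max{1, h}` absorbed in `c`), then `E[ℓ]` is irreducible for every prime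
`ℓ > c · max(1, h_F(E))^γ` (`hasIrreducibleModPGaloisRep_of_forall_isogeny_degree_le`).
[cite: MasserWustholzBLMS1993, §3 Lemma 3.1 and §4 (4.1) (pp. 249–251)] -/
theorem effectiveLemma31_numberFields_of_isogenyEstimate
    (hI : ∃ (c γ : ℝ), 0 ≤ γ ∧ ∀ (k : Type) [Field k] [NumberField k],
      Module.finrank ℚ k ≤ 60 → ∀ (V : WeierstrassCurve k) [V.IsElliptic], ¬ V.HasCM →
        ∀ (V' : WeierstrassCurve k) [V'.IsElliptic], IsIsogenous V V' →
          ∃ ψ : Isogeny V' V, (ψ.degree : ℝ) ≤ c * (max 1 V.stableFaltingsHeight) ^ γ) :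
    ∃ (c γ : ℝ), 0 ≤ γ ∧ ∀ (k : Type) [Field k] [NumberField k],
      Module.finrank ℚ k ≤ 60 → ∀ (V : WeierstrassCurve k) [V.IsElliptic], ¬ V.HasCM →
        ∀ ℓ : ℕ, ℓ.Prime → c * (max 1 V.stableFaltingsHeight) ^ γ < ℓ →
          V.HasIrreducibleModPGaloisRep ℓ := by
  obtain ⟨c, γ, hγ, h⟩ := hI
  refine ⟨c, γ, hγ, fun k _ _ hk V _ hV ℓ hℓ hlt ↦ ?_⟩
  refine hasIrreducibleModPGaloisRep_of_forall_isogeny_degree_le V hV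
    (B := ⌊c * (max 1 V.stableFaltingsHeight) ^ γ⌋₊) (fun V' _ hVV' ↦ ?_) hℓ
    ((Nat.floor_lt' hℓ.ne_zero).mpr hlt)
  obtain ⟨ψ, hψ⟩ := h k hk V hV V' hVV'
  exact ⟨ψ, Nat.le_floor hψ⟩

/-- **(4.1) over `ℚ` from Mazur's theorem.**  Over `k = ℚ` the conclusion of Lemma 3.1 —
irreducibility of `E[ℓ]` beyond `c · max(1, h_F(E))^γ` — also follows, with `c = 163`, `γ = 0`
and for every `E/ℚ` (CM or not), from Mazur's theorem on rational isogenies of prime degree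
(B. Mazur, Invent. Math. 44 (1978), Thm. 1; the tree's named fact `mazur_isogeny_irreducible`,
taken here as a hypothesis): no `E/ℚ` has a rational `ℓ`-isogeny for `ℓ > 163`.  (Masser and
Wüstholz, p. 248: the `ℓ`-isogeny case "was then used in [10] to give some effective estimates
like our Theorem"; over `ℚ` it is uniform.)  This is an alternative source for hypothesis `h31`
of `masserWustholz_surjective_modEll_of_effective_lemmas`; the fields `k₀` of §4 still need the
isogeny estimate. [cite: Mazur1978, Thm 1] -/
theorem effectiveLemma31_of_mazur (hM : mazur_isogeny_irreducible) :
    ∃ (c γ : ℝ), 0 ≤ γ ∧ ∀ (W : WeierstrassCurve ℚ) [W.IsElliptic], ¬ W.HasCM →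
      ∀ ℓ : ℕ, ℓ.Prime → c * (max 1 W.stableFaltingsHeight) ^ γ < ℓ →
        W.HasIrreducibleModPGaloisRep ℓ := by
  refine ⟨163, 0, le_rfl, fun W _ _ ℓ hℓ hlt ↦ hM W ℓ hℓ (not_mem_mazurPrimes_of_lt ?_)⟩
  rw [Real.rpow_zero, mul_one] at hlt
  exact_mod_cast hlt

/-- **Masser–Wüstholz 1993, Theorem (b) over `ℚ`, from the isogeny estimate for elliptic curves
(Lemma 2.2 at `n = 1`) and Lemma 3.2, both over number fields of degree `≤ 60`.**  Granted
(I) absolute `c, γ ≥ 0` such that for every number field `k` with `[k : ℚ] ≤ 60`, every elliptic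
curve `E/k` without complex multiplication over `k̄` and every `E'` isogenous to `E` over `k`
there is an isogeny `E' → E` over `k` of degree `≤ c · max(1, h_F(E))^γ` (Lemma 2.2, `n = 1`,
with `max{d, h} ≤ 60 max{1, h}`), and
(II) absolute `c, γ ≥ 0` such that for the same `k, E` and every prime `ℓ > c · max(1, h_F(E))^γ`
a commutative `φ_ℓ(Gal(k̄/k))` consists of scalars (Lemma 3.2), the named fact
`masserWustholz_surjective_modEll` holds.  Assembly: (I) at `k = ℚ` is (4.1) over `ℚ`
(`effectiveLemma31_of_isogenyEstimate`); (I) and (II) over the fields `k₀` give the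
non-commutativity of `φ_ℓ(G₀)` (`effectiveLemma31_numberFields_of_isogenyEstimate`,
`numberFields_nonComm_of_effective_lemmas`), transported to `ℚ` by
`effectiveLemma32_of_numberFields`; §4 (`masserWustholz_surjective_modEll_of_effective_lemmas`)
concludes.  Hypotheses (I) and (II) are the printed Lemma 2.2 (`n = 1`) and Lemma 3.2 — the
transcendence input of the paper — and are NOT named facts of the tree (D-0026).
[cite: MasserWustholzBLMS1993, Theorem (b) (p. 247) with §§2–4 (pp. 248–251)] -/
theorem masserWustholz_surjective_modEll_of_isogenyEstimate_of_lemma32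
    (hI : ∃ (c γ : ℝ), 0 ≤ γ ∧ ∀ (k : Type) [Field k] [NumberField k],
      Module.finrank ℚ k ≤ 60 → ∀ (V : WeierstrassCurve k) [V.IsElliptic], ¬ V.HasCM →
        ∀ (V' : WeierstrassCurve k) [V'.IsElliptic], IsIsogenous V V' →
          ∃ ψ : Isogeny V' V, (ψ.degree : ℝ) ≤ c * (max 1 V.stableFaltingsHeight) ^ γ)
    (hII : ∃ (c γ : ℝ), 0 ≤ γ ∧ ∀ (k : Type) [Field k] [NumberField k],
      Module.finrank ℚ k ≤ 60 → ∀ (V : WeierstrassCurve k) [V.IsElliptic], ¬ V.HasCM →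
        ∀ ℓ : ℕ, ℓ.Prime → c * (max 1 V.stableFaltingsHeight) ^ γ < ℓ →
          (∀ γ₁ γ₂ : absoluteGaloisGroup k,
            galoisRepTorsion V ℓ γ₁ * galoisRepTorsion V ℓ γ₂ =
              galoisRepTorsion V ℓ γ₂ * galoisRepTorsion V ℓ γ₁) →
          ∀ γ : absoluteGaloisGroup k, ∃ a : ℤ, ∀ P : V.geomPoints,
            P ∈ geomTorsion V ℓ → γ • P = a • P) :
    masserWustholz_surjective_modEll := by
  refine masserWustholz_surjective_modEll_of_effective_lemmas
    (effectiveLemma31_of_isogenyEstimate ?_)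
    (effectiveLemma32_of_numberFields (numberFields_nonComm_of_effective_lemmas
      (effectiveLemma31_numberFields_of_isogenyEstimate hI) hII))
  -- (I) at `k = ℚ`
  obtain ⟨c, γ, hγ, h⟩ := hI
  refine ⟨c, γ, hγ, fun W _ hW W' _ hWW' ↦ ?_⟩
  exact h ℚ (by rw [Module.finrank_self]; norm_num) W hW W' hWW'

end Literature.NumberTheory.EllipticCurves.MasserWustholz1993

end
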